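import Summits.Ventures.PercRepro.MSSplitMono

/-!
# Step 3 of Theorem 10.1: the six classes of a split family of excess one

proofs/P4-gen9.md §10, Step 3. `F = s ⊔ t` is split, its difference family `G = F \\ F` is
down-closed and contains every singleton of the support `u`, no member is a difference, and the
Marica–Schönheim excess is one (`CoverHyp`). FACT (M) (`monochromatic_side`) says that every
coordinate lies in all or in none of the members of one side, and the singleton differences exclude
«in all members of both sides» and «in no member of either side» (`classes_cover`). The six classes
`A₁ = I_s ∩ O_t`, `A₂ = O_s ∩ I_t`, `A₃ = I_s ∖ O_t`, `A₄ = O_s ∖ I_t`, `A₅ = I_t ∖ O_s`,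
`A₆ = O_t ∖ I_s` (`I` = in every member, `O` = in no member) partition `u`.

* `mem_s_eq` / `mem_t_eq` (Step 3b): every member of `s` is `A₁ ∪ A₃ ∪ (its trace on A₅ ∪ A₆)` and
  every member of `t` is `A₂ ∪ A₅ ∪ (its trace on A₃ ∪ A₄)`; the trace maps are injective
  (`card_traces_s`, `card_traces_t`);
* `card_classA1_le_one` / `card_classA2_le_one` (Step 3c, (β)): `|A₁| ≤ 1` and `|A₂| ≤ 1`;
* `diffs_traces_s_subset` / `diffs_traces_t_subset` (Step 3d, (γ)): the differences of the traces
  of one side, together with the class the other side always contains, are good sets inside the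
  half `A₅ ∪ A₆` (resp. `A₃ ∪ A₄`).
-/

namespace PercRepro.MSTight

open Finset
open scoped FinsetFamily

variable {α : Type*} [DecidableEq α]

/-- The standing hypotheses of Theorem 10.1, packaged. -/
structure CoverHyp (u : Finset α) (F s t : Finset (Finset α)) : Prop where
  support : ∀ A ∈ F, A ⊆ u
  split : IsSplit F s t
  down : IsDownSet (F \\ F)
  sing : ∀ r ∈ u, ({r} : Finset α) ∈ F \\ F
  notMem : ∀ A ∈ F, A ∉ F \\ F
  exc : (F \\ F).card = F.card + 1

/-- Swapping the two sides. -/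
theorem CoverHyp.symm {u : Finset α} {F s t : Finset (Finset α)} (h : CoverHyp u F s t) :
    CoverHyp u F t s :=
  ⟨h.support, h.split.symm, h.down, h.sing, h.notMem, h.exc⟩

section Classes

variable {u : Finset α} {F s t : Finset (Finset α)}

/-- `r` lies in every member of `s` (`I_s`). -/
def InAll (s : Finset (Finset α)) (r : α) : Prop := ∀ a ∈ s, r ∈ a
/-- `r` lies in no member of `s` (`O_s`). -/
def InNone (s : Finset (Finset α)) (r : α) : Prop := ∀ a ∈ s, r ∉ a

/-- STEP 3a: FACT (M) at every coordinate, and the two exclusions (`I_s ∩ I_t = ∅`,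
`O_s ∩ O_t = ∅`) from the singleton differences. -/
theorem classes_cover (h : CoverHyp u F s t) (r : α) (hr : r ∈ u) :
    (InAll s r ∨ InNone s r ∨ InAll t r ∨ InNone t r) ∧
      ¬ (InAll s r ∧ InAll t r) ∧ ¬ (InNone s r ∧ InNone t r) := by
  refine ⟨monochromatic_side u h.support h.split h.down h.exc (h.sing r hr), ?_, ?_⟩
  · -- `r` in every member: never a difference
    rintro ⟨h1, h2⟩
    obtain ⟨A, hA, B, hB, hAB⟩ := Finset.mem_diffs.1 (h.sing r hr)
    have hrB : r ∉ B := by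
      have : r ∈ A \ B := by rw [hAB]; exact Finset.mem_singleton_self r
      exact (Finset.mem_sdiff.1 this).2
    rw [← h.split.union] at hB
    rcases Finset.mem_union.1 hB with hB | hB
    · exact hrB (h1 B hB)
    · exact hrB (h2 B hB)
  · -- `r` in no member: not in a difference
    rintro ⟨h1, h2⟩
    obtain ⟨A, hA, B, hB, hAB⟩ := Finset.mem_diffs.1 (h.sing r hr)
    have hrA : r ∈ A := by
      have : r ∈ A \ B := by rw [hAB]; exact Finset.mem_singleton_self r
      exact (Finset.mem_sdiff.1 this).1
    rw [← h.split.union] at hA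
    rcases Finset.mem_union.1 hA with hA | hA
    · exact h1 A hA hrA
    · exact h2 A hA hrA

open Classical in
/-- `A₁ = I_s ∩ O_t`. -/
noncomputable def classA1 (u : Finset α) (s t : Finset (Finset α)) : Finset α :=
  u.filter fun r => InAll s r ∧ InNone t r
open Classical in
/-- `A₂ = O_s ∩ I_t`. -/
noncomputable def classA2 (u : Finset α) (s t : Finset (Finset α)) : Finset α :=
  u.filter fun r => InNone s r ∧ InAll t r
open Classical in
/-- `A₃ = I_s ∖ O_t`. -/
noncomputable def classA3 (u : Finset α) (s t : Finset (Finset α)) : Finset α :=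
  u.filter fun r => InAll s r ∧ ¬ InNone t r
open Classical in
/-- `A₄ = O_s ∖ I_t`. -/
noncomputable def classA4 (u : Finset α) (s t : Finset (Finset α)) : Finset α :=
  u.filter fun r => InNone s r ∧ ¬ InAll t r
open Classical in
/-- `A₅ = I_t ∖ O_s`. -/
noncomputable def classA5 (u : Finset α) (s t : Finset (Finset α)) : Finset α :=
  u.filter fun r => InAll t r ∧ ¬ InNone s r
open Classical in
/-- `A₆ = O_t ∖ I_s`. -/
noncomputable def classA6 (u : Finset α) (s t : Finset (Finset α)) : Finset α :=
  u.filter fun r => InNone t r ∧ ¬ InAll s r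

omit [DecidableEq α] in
/-- Membership in `A₁`. -/
theorem mem_classA1 {r : α} : r ∈ classA1 u s t ↔ r ∈ u ∧ InAll s r ∧ InNone t r := by
  simp [classA1]
omit [DecidableEq α] in
/-- Membership in `A₂`. -/
theorem mem_classA2 {r : α} : r ∈ classA2 u s t ↔ r ∈ u ∧ InNone s r ∧ InAll t r := by
  simp [classA2]
omit [DecidableEq α] in
/-- Membership in `A₃`. -/
theorem mem_classA3 {r : α} : r ∈ classA3 u s t ↔ r ∈ u ∧ InAll s r ∧ ¬ InNone t r := by
  simp [classA3]
omit [DecidableEq α] in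
/-- Membership in `A₄`. -/
theorem mem_classA4 {r : α} : r ∈ classA4 u s t ↔ r ∈ u ∧ InNone s r ∧ ¬ InAll t r := by
  simp [classA4]
omit [DecidableEq α] in
/-- Membership in `A₅`. -/
theorem mem_classA5 {r : α} : r ∈ classA5 u s t ↔ r ∈ u ∧ InAll t r ∧ ¬ InNone s r := by
  simp [classA5]
omit [DecidableEq α] in
/-- Membership in `A₆`. -/
theorem mem_classA6 {r : α} : r ∈ classA6 u s t ↔ r ∈ u ∧ InNone t r ∧ ¬ InAll s r := by
  simp [classA6]

omit [DecidableEq α] in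
/-- The classes are symmetric under swapping the sides: `A₁ ↔ A₂`, `A₃ ↔ A₅`, `A₄ ↔ A₆`. -/
theorem classA2_symm : classA2 u t s = classA1 u s t := by
  ext r; rw [mem_classA2, mem_classA1]; tauto
omit [DecidableEq α] in
/-- Swapping the sides turns `A₅` into `A₃`. -/
theorem classA5_symm : classA5 u t s = classA3 u s t := by
  ext r; rw [mem_classA5, mem_classA3]
omit [DecidableEq α] in
/-- Swapping the sides turns `A₆` into `A₄`. -/
theorem classA6_symm : classA6 u t s = classA4 u s t := by
  ext r; rw [mem_classA6, mem_classA4]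

open Classical in
/-- STEP 3b: every member of `s` is `A₁ ∪ A₃ ∪ (its trace on A₅ ∪ A₆)`. -/
theorem mem_s_eq (h : CoverHyp u F s t) {a : Finset α} (ha : a ∈ s) :
    a = classA1 u s t ∪ classA3 u s t ∪ (a ∩ (classA5 u s t ∪ classA6 u s t)) := by
  have haF : a ∈ F := by rw [← h.split.union]; exact Finset.mem_union_left t ha
  ext x
  simp only [Finset.mem_union, Finset.mem_inter, mem_classA1, mem_classA3, mem_classA5,
    mem_classA6]
  constructor
  · intro hx
    have hxu : x ∈ u := h.support a haF hx
    have hns : ¬ InNone s x := fun hn => hn a ha hx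
    obtain ⟨hc, -, -⟩ := classes_cover h x hxu
    by_cases hIs : InAll s x
    · by_cases hOt : InNone t x
      · exact Or.inl (Or.inl ⟨hxu, hIs, hOt⟩)
      · exact Or.inl (Or.inr ⟨hxu, hIs, hOt⟩)
    · rcases hc with hc | hc | hc | hc
      · exact absurd hc hIs
      · exact absurd hc hns
      · exact Or.inr ⟨hx, Or.inl ⟨hxu, hc, hns⟩⟩
      · exact Or.inr ⟨hx, Or.inr ⟨hxu, hc, hIs⟩⟩
  · rintro ((⟨-, hIs, -⟩ | ⟨-, hIs, -⟩) | ⟨hx, -⟩)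
    · exact hIs a ha
    · exact hIs a ha
    · exact hx

open Classical in
/-- STEP 3b′: every member of `t` is `A₂ ∪ A₅ ∪ (its trace on A₃ ∪ A₄)`. -/
theorem mem_t_eq (h : CoverHyp u F s t) {b : Finset α} (hb : b ∈ t) :
    b = classA2 u s t ∪ classA5 u s t ∪ (b ∩ (classA3 u s t ∪ classA4 u s t)) := by
  have hbF : b ∈ F := by rw [← h.split.union]; exact Finset.mem_union_right s hb
  ext x
  simp only [Finset.mem_union, Finset.mem_inter, mem_classA2, mem_classA5, mem_classA3,
    mem_classA4]
  constructor
  · intro hx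
    have hxu : x ∈ u := h.support b hbF hx
    have hnt : ¬ InNone t x := fun hn => hn b hb hx
    obtain ⟨hc, -, -⟩ := classes_cover h x hxu
    by_cases hIt : InAll t x
    · by_cases hOs : InNone s x
      · exact Or.inl (Or.inl ⟨hxu, hOs, hIt⟩)
      · exact Or.inl (Or.inr ⟨hxu, hIt, hOs⟩)
    · rcases hc with hc | hc | hc | hc
      · exact Or.inr ⟨hx, Or.inl ⟨hxu, hc, hnt⟩⟩
      · exact Or.inr ⟨hx, Or.inr ⟨hxu, hc, hIt⟩⟩
      · exact absurd hc hIt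
      · exact absurd hc hnt
  · rintro ((⟨-, -, hIt⟩ | ⟨-, hIt, -⟩) | ⟨hx, -⟩)
    · exact hIt b hb
    · exact hIt b hb
    · exact hx

open Classical in
/-- The trace map of `s` on `A₅ ∪ A₆` is injective: `|T| = |s|`. -/
theorem card_traces_s (h : CoverHyp u F s t) :
    (s.image fun a => a ∩ (classA5 u s t ∪ classA6 u s t)).card = s.card := by
  refine Finset.card_image_of_injOn fun a ha a' ha' heq => ?_
  rw [mem_s_eq h ha, mem_s_eq h ha']
  rw [heq]

open Classical in
/-- The trace map of `t` on `A₃ ∪ A₄` is injective: `|S| = |t|`. -/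
theorem card_traces_t (h : CoverHyp u F s t) :
    (t.image fun b => b ∩ (classA3 u s t ∪ classA4 u s t)).card = t.card := by
  refine Finset.card_image_of_injOn fun b hb b' hb' heq => ?_
  rw [mem_t_eq h hb, mem_t_eq h hb']
  rw [heq]

open Classical in
/-- STEP 3c (β): `|A₁| ≤ 1` — a singleton `{a₁}` with `a₁ ∈ A₁` is only a cross difference
`a \ b` (`a ∈ s`, `b ∈ t`), which contains all of `A₁`. -/
theorem card_classA1_le_one (h : CoverHyp u F s t) : (classA1 u s t).card ≤ 1 := by
  refine Finset.card_le_one.2 fun x hx y hy => ?_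
  obtain ⟨hxu, hxs, hxt⟩ := mem_classA1.1 hx
  obtain ⟨-, hys, hyt⟩ := mem_classA1.1 hy
  obtain ⟨A, hA, B, hB, hAB⟩ := Finset.mem_diffs.1 (h.sing x hxu)
  have hxAB : x ∈ A \ B := by rw [hAB]; exact Finset.mem_singleton_self x
  obtain ⟨hxA, hxB⟩ := Finset.mem_sdiff.1 hxAB
  have hAs : A ∈ s := by
    rw [← h.split.union] at hA
    rcases Finset.mem_union.1 hA with hA | hA
    · exact hA
    · exact absurd hxA (hxt A hA)
  have hBt : B ∈ t := by
    rw [← h.split.union] at hB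
    rcases Finset.mem_union.1 hB with hB | hB
    · exact absurd (hxs B hB) hxB
    · exact hB
  have hyAB : y ∈ A \ B := Finset.mem_sdiff.2 ⟨hys A hAs, hyt B hBt⟩
  rw [hAB] at hyAB
  exact (Finset.mem_singleton.1 hyAB).symm

open Classical in
/-- STEP 3c′ (β): `|A₂| ≤ 1`. -/
theorem card_classA2_le_one (h : CoverHyp u F s t) : (classA2 u s t).card ≤ 1 := by
  rw [classA2_symm (s := t) (t := s)]
  exact card_classA1_le_one h.symm

open Classical in
/-- STEP 3d (γ): the differences of the traces of `s` on `A₅ ∪ A₆`, together with `A₅`, are good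
sets inside `A₅ ∪ A₆` (`t ∖ A₅ = t ∩ A₆ ⊆ a ∖ b`, `A₅ ∖ t ⊆ b ∖ a`, `G` down-closed). -/
theorem diffs_traces_s_subset (h : CoverHyp u F s t) :
    (insert (classA5 u s t) (s.image fun a => a ∩ (classA5 u s t ∪ classA6 u s t))) \\
      (insert (classA5 u s t) (s.image fun a => a ∩ (classA5 u s t ∪ classA6 u s t))) ⊆
      (F \\ F).filter fun W => W ⊆ classA5 u s t ∪ classA6 u s t := by
  obtain ⟨b₀, hb₀⟩ := h.split.ne_t
  have hb₀F : b₀ ∈ F := by rw [← h.split.union]; exact Finset.mem_union_right s hb₀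
  have hsF : ∀ a ∈ s, a ∈ F := fun a ha => by
    rw [← h.split.union]; exact Finset.mem_union_left t ha
  have hG : ∀ {W A B : Finset α}, A ∈ F → B ∈ F → W ⊆ A \ B → W ∈ F \\ F :=
    fun hA hB hsub => h.down _ (Finset.mem_diffs.2 ⟨_, hA, _, hB, rfl⟩) _ hsub
  have hsubR : ∀ c ∈ insert (classA5 u s t)
      (s.image fun a => a ∩ (classA5 u s t ∪ classA6 u s t)),
      c ⊆ classA5 u s t ∪ classA6 u s t := by
    intro c hc
    rcases Finset.mem_insert.1 hc with rfl | hc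
    · exact Finset.subset_union_left
    · obtain ⟨a, -, rfl⟩ := Finset.mem_image.1 hc
      exact Finset.inter_subset_right
  intro W hW
  obtain ⟨c, hc, c', hc', rfl⟩ := Finset.mem_diffs.1 hW
  refine Finset.mem_filter.2 ⟨?_, Finset.sdiff_subset.trans (hsubR c hc)⟩
  rcases Finset.mem_insert.1 hc with rfl | hca <;> rcases Finset.mem_insert.1 hc' with rfl | hca'
  · -- `A₅ \ A₅ = ∅`
    exact hG hb₀F hb₀F (by rw [Finset.sdiff_self]; exact Finset.empty_subset _)
  · -- `A₅ \ (a ∩ (A₅ ∪ A₆)) = A₅ \ a ⊆ b₀ \ a`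
    obtain ⟨a, ha, rfl⟩ := Finset.mem_image.1 hca'
    refine hG hb₀F (hsF a ha) ?_
    intro x hx
    obtain ⟨hx5, hxa⟩ := Finset.mem_sdiff.1 hx
    refine Finset.mem_sdiff.2 ⟨(mem_classA5.1 hx5).2.1 b₀ hb₀, fun hxa' => hxa ?_⟩
    exact Finset.mem_inter.2 ⟨hxa', Finset.mem_union_left _ hx5⟩
  · -- `(a ∩ (A₅ ∪ A₆)) \ A₅ = a ∩ A₆ ⊆ a \ b₀`
    obtain ⟨a, ha, rfl⟩ := Finset.mem_image.1 hca
    refine hG (hsF a ha) hb₀F ?_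
    intro x hx
    obtain ⟨hxa, hx5⟩ := Finset.mem_sdiff.1 hx
    obtain ⟨hxa, hxR⟩ := Finset.mem_inter.1 hxa
    refine Finset.mem_sdiff.2 ⟨hxa, ?_⟩
    rcases Finset.mem_union.1 hxR with h5 | h6
    · exact absurd h5 hx5
    · exact (mem_classA6.1 h6).2.1 b₀ hb₀
  · -- `(a ∩ R) \ (a' ∩ R) ⊆ a \ a'`
    obtain ⟨a, ha, rfl⟩ := Finset.mem_image.1 hca
    obtain ⟨a', ha', rfl⟩ := Finset.mem_image.1 hca'
    refine hG (hsF a ha) (hsF a' ha') ?_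
    intro x hx
    obtain ⟨hxa, hxa'⟩ := Finset.mem_sdiff.1 hx
    exact Finset.mem_sdiff.2 ⟨(Finset.mem_inter.1 hxa).1,
      fun h' => hxa' (Finset.mem_inter.2 ⟨h', (Finset.mem_inter.1 hxa).2⟩)⟩

open Classical in
/-- STEP 3d′ (γ): the differences of the traces of `t` on `A₃ ∪ A₄`, together with `A₃`, are good
sets inside `A₃ ∪ A₄`. -/
theorem diffs_traces_t_subset (h : CoverHyp u F s t) :
    (insert (classA3 u s t) (t.image fun b => b ∩ (classA3 u s t ∪ classA4 u s t))) \\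
      (insert (classA3 u s t) (t.image fun b => b ∩ (classA3 u s t ∪ classA4 u s t))) ⊆
      (F \\ F).filter fun W => W ⊆ classA3 u s t ∪ classA4 u s t := by
  have := diffs_traces_s_subset h.symm
  rwa [classA5_symm, classA6_symm] at this

end Classes

end PercRepro.MSTight
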